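import Literature.MathematicalPhysics.QuantumFieldTheory.Balaban1983to89.B11Eq177CriticalFamilyDerivative

/-!
# `Balaban1983to89.B16Ineq17NearFlatOneSided` — [Balaban1989LargeFieldII] (1.7) pp. 357–358 AT A NEAR-FLAT BACKGROUND `U₀ ≠ 1`, ONE-SIDED:
# the ASSEMBLY SKELETON of «we write U₀ = exp(iA₀) and expand in A₀ up to first order … the leading term in the expansion is the quadratic
# form with the background field identically equal to 1 … |E_A| ≤ O(1)M⁶R_kε_k|B′|²» read at a CONSTRAINED-CRITICAL background (multiplier
# `λ₀ ≠ 0`), with an EXPLICIT error constant `Cerr` in terms of four displayed smallness letters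

statement-level skeleton of published theorems with citation tags; proofs where landed; nothing here is a claim about
the Yang–Mills mass gap.

T. Bałaban, *Large field renormalization. II*, Commun. Math. Phys. **122** (1989) 355–392 [Balaban1989LargeFieldII], Sect. 1 pp. 357–359:
(1.3)–(1.7) (the function `B′ ↦ A(U_{k,Z}((exp iB′)V_k))` and its expansion), (1.12) («⟨δB′, H_{1,k}J_{k,Z}⟩ + ⟨δB′, H_{1,k}Δ₁H_{1,k}B′⟩ + …»);
T. Bałaban, *The variational problem and background fields …*, Commun. Math. Phys. **102** (1985) 277–309 [Balaban1985Variational], Sect. C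
(36)–(47) pp. 283–285 (the linearised minimiser `H`), (82)–(83) p. 290, Sect. G (174)–(177) pp. 305–306; T. Bałaban, *Propagators and
renormalization transformations … I*, Commun. Math. Phys. **95** (1984) 17–40 [Balaban1984PropagatorsI], (1.64)–(1.67) p. 29 (the flat effective
form `⟨B′, Δ_kB′⟩ = inf{⟨A, ΔA⟩ : Q_kA = B′}`).

Cell pub-ymgap, HUMAN RULING D-0062 ∕ D-0149, seat `pub-ymgap-dag-n12-w4` g2 (WIDTH SEAT 4 of DAG node N12 = [B15]; U2c lane = «assembler of the
(L2) DISPLAY route at the record» per the lane map of `pub-ymgap-dag-n12-c` g16, 2026-08-28 01:10Z; key K1⁷ stmt-QuantumFields-20542, helper,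
count-neutral).  CONSUMED BY NAME, nothing restated: dag-n12-w3's `B11Eq177CriticalFamilyDerivative` §1 ★★ `hessian_value_criticalFamily`
(the (1.12) SHAPE: value Hessian `= q(γ′h, γ′h) + λ₀(D²(Φ∘γ))`, `q = a₂ − λ₀∘Φ₂` the Lagrangian Hessian) and §4 ★★
`hessian_value_le_secondVariation_of_fderiv_eq_zero` (at the flat, unconstrained-critical base the value Hessian is the MINIMUM of the flat
second variation over the flat linearised fibre — [10] (1.64)–(1.66)).

THE SITUATION (print p. 357).  At step `k ≥ 1` the background `U₀ = U_{k,Z}(V_k)` of (1.3) is a CONSTRAINED minimiser of the Wilson action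
(`Da(x₀) = λ₀ ∘ DΦ(x₀)` with `λ₀ ≠ 0` — the current `J_{k,Z}` of (1.12) does not vanish), it is NOT flat but NEAR-flat (small field on `Z`,
gauge-fixed small `A₀`).  The flat case `U₀ = 1`, `λ₀ = 0`, `k = 0` is dag-n12-w3's §4 + `B16Ineq19FlatSliceChart` (`γ₀ = 1`, `Cerr = 0`); the
g0 seat's `B16Ineq17FlatRouteConstants.h17_rawUnits_of_flat_chain` takes the splitting `Qv = Q♭ + E_A`, `|E_A| ≤ Cerr‖X‖²` as a HYPOTHESIS.  THIS
FILE PRODUCES THAT SPLITTING, ONE-SIDED, from named letters, in the abstract currency of `B11Eq177CriticalFamilyDerivative` §1 (real normed `E`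
= configurations in a chart at `U₀`, `V` = data in a chart at `V_k`).

THE LETTERS (all DISPLAYED — inhabited at NODE 00's objects by other pens, NOT typed and NOT claimed small here).  With `w := γ′h` the
velocity of the critical family (`= H₁y`, dag-n12-w3 ★★★ `fderiv_criticalFamily_eq_linearisedMinimiser`), `y := DΦ(x₀)w` the datum velocity,
the FLAT data `B♭` (the flat second variation `D²(A∘expChart 1)(0)`, dag-n12-w2's `Q_1`), `L♭` (the flat linearised constraint `Q^{(k)}`,
dag-n10-w1's recursion letter) with a right inverse `R♭` (`L♭ ∘ R♭ = id`, `‖R♭v‖ ≤ ρ‖v‖`):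
* (δ₁) `B♭(w,w) − δ₁‖w‖² ≤ a₂(w,w)` — the second variation at `U₀` versus at `1`: dag-n12-w2's letter (b)
  (`Node00.abs_deriv_deriv_wilsonAction4_expChart_sub_flat_le_local`, p587195; left chart p592028), `δ₁ = 4·max_p δ_p`-type;
* (μ) `λ₀(Φ₂(w,w)) ≤ μ‖w‖²` — multiplier × curvature of the averaging chart (`λ₀ = Da(x₀) ∘ R`, `R` a right inverse of `DΦ(x₀)`:
  `μ = ‖J(U₀)‖·‖R‖·‖Φ₂‖`, the CURRENT at the small-field background);
* (δ₂) `‖DΦ(x₀)w − L♭w‖ ≤ δ₂‖w‖` — the linearised averaging at the gauge-fixed small background versus the flat one;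
* (β), (K) `|B♭(u,v)| ≤ β‖u‖‖v‖`, `‖w‖ ≤ K‖y‖` (the flat form is bounded; the linearised minimiser is bounded, [15] Sect. C–E).
THE MECHANISM: the fibre is MOVED — `w′ := w + R♭(y − L♭w)` has `L♭w′ = y` and `‖w′ − w‖ ≤ ρδ₂‖w‖` — and the form is moved by (δ₁) + (μ).

WHAT THIS FILE PROVES (THEOREMS ONLY — no `def`, no `sorry`; axioms standard).
§1 (pure normed-space algebra, no calculus) `fibreTransfer_constraint`, `norm_fibreTransfer_sub_le`, `abs_bilin_diag_sub_le`, ★★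
   `secondVariation_ge_flatMin_sub` (for EVERY `m` with «`m ≤ B♭(w′,w′)` whenever `L♭w′ = y`»: `m − (δ₁ + βρδ₂(2 + ρδ₂))‖w‖² ≤ a₂(w,w)`),
   ★★ `lagrangeHessian_ge_flatMin_sub` (`m − (δ₁ + μ + βρδ₂(2 + ρδ₂))‖w‖² ≤ a₂(w,w) − λ₀(Φ₂(w,w))`),
   `lagrangeHessian_ge_flatMin_sub_of_norm_le` (the same with `K²‖y‖²`: `Cerr = (δ₁ + μ + βρδ₂(2 + ρδ₂))·K²`); `abs_multiplier_apply_le` ∕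
   `multiplier_letter_of_current` (letter (μ) DECOMPOSED: `λ₀ = Da(x₀) ∘ R` ⇒ `μ = j·ρ·M₂` from the current bound `j`, the right-inverse bound `ρ` of
   `DΦ(x₀)` and the curvature `‖Φ₂(w,w)‖ ≤ M₂‖w‖²` of the constraint chart).
§2 ★★ `hessian_value_criticalFamily_ge_flatMin_sub` — the (1.12) shape (dag-n12-w3) + a datum map AFFINE in the parameter (print's `B′` itself:
   `λ₀(D²(Φ∘γ)(g₀)[h,h]) = 0`) ⇒ `m − Cerr′‖γ′h‖² ≤ D²(a∘γ)(g₀)[h,h]`; `…_of_norm_le` (`Cerr‖y‖²` form).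
§3 ★ `hessian_value_nearFlat_ge_hessian_value_flat_sub` — PRINT'S SENTENCE, ONE-SIDED: for two families with the SAME datum velocity `y` — `γ`
   through the near-flat constrained-critical `x₀`, `γ♭` through the flat unconstrained-critical `x♭` (`Da♭(x♭) = 0`, members tangent-critical,
   `D²a♭(x♭) ≥ 0` on `ker DΦ♭(x♭)`; `B♭ := D²a♭(x♭)`, `L♭ := DΦ♭(x♭)`) — the value Hessian at the near-flat background DOMINATES the value
   Hessian at the flat background (`= ⟨B′, Δ_kB′⟩` by dag-n12-w3 §4) minus `Cerr′‖γ′h‖²`.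

HONEST SCOPE.  Structure only: two inequalities of normed-space algebra and one chain of dag-n12-w3's identities.  The letters (δ₁)(μ)(δ₂)(β)(K)(ρ)
are hypotheses about numbers at ONE velocity `w`; their inhabitation at NODE 00's objects ((δ₁): dag-n12-w2 ✓ at `wilsonAction4`; (μ)(δ₂)(K)(ρ):
NODE 00's current ∕ averaging-chart ∕ [15] Sect. C–E bounds at the gauge-fixed small background — n07-e ∕ dag-n12-w1 ∕ NODE 00 lanes) is NOT
here; the Federbush instance `m := γ₀·circ(X)` of the lane (g0 `B16Ineq17FlatRouteConstants.gamma0_circ_le_of_flat_chain` + dag-n10-w1's (J-b)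
`sum_normSq_oc_le_of_agreeOn`, p592369) is NOT imported (it enters through the hypothesis `hm`); nothing of Bałaban's is asserted; count-neutral;
N12 NOT discharged; K1⁷ NOT closed; one finite 𝕋⁴ programme at fixed `ε`; R4 closes the conditional finite-𝕋⁴ rung `BalabanLadder.UV` only — the
Yang–Mills mass gap (Clay) is NOT proved by any of this; nothing continuum ∕ ℝ⁴ ∕ OS.

## References
* [Balaban1989LargeFieldII] T. Bałaban, Commun. Math. Phys. 122 (1989) 355–392: p. 357 («expand in A₀ up to first order»; «the quadratic form with the
  background field identically equal to 1»), (1.7) p. 358, (1.12) p. 359.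
* [Balaban1985Variational] T. Bałaban, Commun. Math. Phys. 102 (1985) 277–309: (36)–(47) pp. 283–285, (82)–(83) p. 290, (174)–(177) pp. 305–306.
* [Balaban1984PropagatorsI] T. Bałaban, Commun. Math. Phys. 95 (1984) 17–40: (1.64)–(1.67) p. 29.
-/

noncomputable section

open Filter Topology Set
open scoped Topology

namespace Literature.MathematicalPhysics.QuantumFieldTheory.Balaban1983to89.B16Ineq17NearFlatOneSided

open B11Eq177CriticalFamilyDerivative (hessian_value_criticalFamily hessian_value_le_secondVariation_of_fderiv_eq_zero)

/-! ## §1  Normed-space algebra: moving the fibre by a right inverse of the flat constraint, moving the form by the letters -/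

section Algebra

variable {E V : Type*} [NormedAddCommGroup E] [NormedSpace ℝ E] [NormedAddCommGroup V] [NormedSpace ℝ V]

/-- **MOVING THE FIBRE**: with a right inverse `R♭` of the flat linearised constraint `L♭` (`L♭(R♭v) = v`; print: `Q` is onto, `Q*(QQ*)⁻¹`
∕ `H` are right inverses), the corrected velocity `w′ := w + R♭(y − L♭w)` lies on the FLAT linearised fibre of the datum velocity `y`:
`L♭w′ = y`. [cite: Balaban1985Variational, (36)–(37) p.283, (45)–(47) p.285 (bookkeeping)] -/
theorem fibreTransfer_constraint (Lf : E →L[ℝ] V) {Rf : V → E} (hRf : ∀ v, Lf (Rf v) = v) (w : E) (y : V) :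
    Lf (w + Rf (y - Lf w)) = y := by
  rw [map_add, hRf]
  abel

/-- **THE MOVE IS SMALL**: if `w` lies on the ACTUAL linearised fibre (`Lw = y`), the actual and flat linearised constraints differ on `w` by
`δ₂‖w‖` (letter (δ₂): the linearised averaging at the gauge-fixed small background versus at `1`) and `‖R♭v‖ ≤ ρ‖v‖`, then
`‖w′ − w‖ ≤ ρδ₂‖w‖`. [cite: Balaban1989LargeFieldII, p.357 («expand in A₀ up to first order»); Balaban1985Variational, (36)–(37) p.283 (bookkeeping)] -/
theorem norm_fibreTransfer_sub_le (L Lf : E →L[ℝ] V) {Rf : V → E} {ρ δ₂ : ℝ} (hρ0 : 0 ≤ ρ) (hρ : ∀ v, ‖Rf v‖ ≤ ρ * ‖v‖)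
    {w : E} {y : V} (hLw : L w = y) (hδ₂ : ‖L w - Lf w‖ ≤ δ₂ * ‖w‖) :
    ‖(w + Rf (y - Lf w)) - w‖ ≤ ρ * δ₂ * ‖w‖ := by
  rw [add_sub_cancel_left, ← hLw]
  calc ‖Rf (L w - Lf w)‖ ≤ ρ * ‖L w - Lf w‖ := hρ _
    _ ≤ ρ * (δ₂ * ‖w‖) := mul_le_mul_of_nonneg_left hδ₂ hρ0
    _ = ρ * δ₂ * ‖w‖ := by ring

/-- **MOVING THE DIAGONAL OF A BOUNDED BILINEAR FORM**: `|B(w′,w′) − B(w,w)| ≤ β‖w′ − w‖(‖w′‖ + ‖w‖)` for `|B(u,v)| ≤ β‖u‖‖v‖`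
(`B(w′,w′) − B(w,w) = B(w′ − w, w′) + B(w, w′ − w)`). [cite: Balaban1989LargeFieldII, (1.7) p.358 (bookkeeping)] -/
theorem abs_bilin_diag_sub_le (B : E →L[ℝ] E →L[ℝ] ℝ) {β : ℝ} (hβ : ∀ u v, |B u v| ≤ β * ‖u‖ * ‖v‖) (w w' : E) :
    |B w' w' - B w w| ≤ β * ‖w' - w‖ * (‖w'‖ + ‖w‖) := by
  have h : B w' w' - B w w = B (w' - w) w' + B w (w' - w) := by
    simp only [map_sub, sub_apply]
    ring
  rw [h]
  calc |B (w' - w) w' + B w (w' - w)| ≤ |B (w' - w) w'| + |B w (w' - w)| := abs_add_le _ _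
    _ ≤ β * ‖w' - w‖ * ‖w'‖ + β * ‖w‖ * ‖w' - w‖ := add_le_add (hβ _ _) (hβ _ _)
    _ = β * ‖w' - w‖ * (‖w'‖ + ‖w‖) := by ring

/-- ★★ **THE SECOND VARIATION AT THE NEAR-FLAT BACKGROUND DOMINATES THE FLAT EFFECTIVE FORM, ONE-SIDED** («the leading term in the expansion is the
quadratic form with the background field identically equal to 1», p. 357; (1.7) p. 358).  DATA: the flat second variation `B♭` with
`|B♭(u,v)| ≤ β‖u‖‖v‖`; the actual ∕ flat linearised constraints `L`, `L♭`, a right inverse `R♭` of `L♭` with `‖R♭v‖ ≤ ρ‖v‖`; ONE velocity `w` on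
the actual fibre of the datum velocity `y` (`Lw = y`) with the letters (δ₂) `‖Lw − L♭w‖ ≤ δ₂‖w‖` and (δ₁) `B♭(w,w) − δ₁‖w‖² ≤ A` (`A` = the
second variation `a₂(w,w)` at the background — dag-n12-w2's letter (b)).  THEN for EVERY `m` dominated by `B♭` on the flat fibre of `y`
(«`m ≤ B♭(w′,w′)` whenever `L♭w′ = y`» — [10] (1.64)–(1.66)'s `⟨B′, Δ_kB′⟩`, or the lane's Federbush lower bound `γ₀·circ`):
`m − (δ₁ + βρδ₂(2 + ρδ₂))‖w‖² ≤ A`. [cite: Balaban1989LargeFieldII, (1.7) pp.357–358; Balaban1984PropagatorsI, (1.64)–(1.67) p.29] -/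
theorem secondVariation_ge_flatMin_sub (Bf : E →L[ℝ] E →L[ℝ] ℝ) (L Lf : E →L[ℝ] V) {Rf : V → E}
    {δ₁ β ρ δ₂ : ℝ} (hβ0 : 0 ≤ β) (hρ0 : 0 ≤ ρ)
    (hβ : ∀ u v, |Bf u v| ≤ β * ‖u‖ * ‖v‖) (hRf : ∀ v, Lf (Rf v) = v) (hρ : ∀ v, ‖Rf v‖ ≤ ρ * ‖v‖)
    {w : E} {y : V} (hLw : L w = y) (hδ₂ : ‖L w - Lf w‖ ≤ δ₂ * ‖w‖)
    {A : ℝ} (hδ₁ : Bf w w - δ₁ * ‖w‖ ^ 2 ≤ A)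
    {m : ℝ} (hm : ∀ w', Lf w' = y → m ≤ Bf w' w') :
    m - (δ₁ + β * (ρ * δ₂) * (2 + ρ * δ₂)) * ‖w‖ ^ 2 ≤ A := by
  set w' : E := w + Rf (y - Lf w) with hw'
  have hLf : Lf w' = y := fibreTransfer_constraint Lf hRf w y
  have he : ‖w' - w‖ ≤ ρ * δ₂ * ‖w‖ := norm_fibreTransfer_sub_le L Lf hρ0 hρ hLw hδ₂
  have hm' : m ≤ Bf w' w' := hm w' hLf
  have he0 : 0 ≤ ‖w' - w‖ := norm_nonneg _
  have hwn : 0 ≤ ‖w‖ := norm_nonneg _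
  have hE0 : 0 ≤ ρ * δ₂ * ‖w‖ := le_trans he0 he
  have hw'n : ‖w'‖ ≤ ‖w‖ + ‖w' - w‖ := by
    calc ‖w'‖ = ‖w + (w' - w)‖ := by rw [add_sub_cancel]
      _ ≤ ‖w‖ + ‖w' - w‖ := norm_add_le _ _
  -- the diagonal moves by at most `β·ρδ₂‖w‖·(2‖w‖ + ρδ₂‖w‖)`
  have hbd : |Bf w' w' - Bf w w| ≤ β * (ρ * δ₂) * (2 + ρ * δ₂) * ‖w‖ ^ 2 := by
    have h1 : β * ‖w' - w‖ * (‖w'‖ + ‖w‖) ≤ β * ‖w' - w‖ * (2 * ‖w‖ + ‖w' - w‖) :=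
      mul_le_mul_of_nonneg_left (by linarith) (mul_nonneg hβ0 he0)
    have h2 : β * ‖w' - w‖ * (2 * ‖w‖ + ‖w' - w‖) ≤ β * (ρ * δ₂ * ‖w‖) * (2 * ‖w‖ + ‖w' - w‖) :=
      mul_le_mul_of_nonneg_right (mul_le_mul_of_nonneg_left he hβ0) (by positivity)
    have h3 : β * (ρ * δ₂ * ‖w‖) * (2 * ‖w‖ + ‖w' - w‖) ≤ β * (ρ * δ₂ * ‖w‖) * (2 * ‖w‖ + ρ * δ₂ * ‖w‖) :=
      mul_le_mul_of_nonneg_left (by linarith) (mul_nonneg hβ0 hE0)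
    have h4 : β * (ρ * δ₂ * ‖w‖) * (2 * ‖w‖ + ρ * δ₂ * ‖w‖) = β * (ρ * δ₂) * (2 + ρ * δ₂) * ‖w‖ ^ 2 := by ring
    calc |Bf w' w' - Bf w w| ≤ β * ‖w' - w‖ * (‖w'‖ + ‖w‖) := abs_bilin_diag_sub_le Bf hβ w w'
      _ ≤ β * (ρ * δ₂) * (2 + ρ * δ₂) * ‖w‖ ^ 2 := by linarith
  have hlow : Bf w' w' - β * (ρ * δ₂) * (2 + ρ * δ₂) * ‖w‖ ^ 2 ≤ Bf w w := by
    have := (abs_le.mp hbd).2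
    linarith
  have key : (δ₁ + β * (ρ * δ₂) * (2 + ρ * δ₂)) * ‖w‖ ^ 2
      = δ₁ * ‖w‖ ^ 2 + β * (ρ * δ₂) * (2 + ρ * δ₂) * ‖w‖ ^ 2 := by ring
  rw [key]
  linarith

/-- ★★ **THE LAGRANGIAN HESSIAN AT THE NEAR-FLAT CONSTRAINED-CRITICAL BACKGROUND DOMINATES THE FLAT EFFECTIVE FORM, ONE-SIDED** — (1.12)'s `Δ₁` is
the Lagrangian Hessian `q = a₂ − λ₀∘Φ₂` ([15] (47)); with the multiplier letter (μ) `λ₀(Φ₂(w,w)) ≤ μ‖w‖²` (the current `J` of (1.12) at the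
small-field background times the curvature of the averaging chart) on top of `secondVariation_ge_flatMin_sub`'s data:
`m − (δ₁ + μ + βρδ₂(2 + ρδ₂))‖w‖² ≤ a₂(w,w) − λ₀(Φ₂(w,w))` (the two real numbers `A`, `ℓ`).
[cite: Balaban1989LargeFieldII, (1.7) p.358, (1.12) p.359; Balaban1985Variational, (47) p.285, (82)–(83) p.290] -/
theorem lagrangeHessian_ge_flatMin_sub (Bf : E →L[ℝ] E →L[ℝ] ℝ) (L Lf : E →L[ℝ] V) {Rf : V → E}
    {δ₁ μ β ρ δ₂ : ℝ} (hβ0 : 0 ≤ β) (hρ0 : 0 ≤ ρ)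
    (hβ : ∀ u v, |Bf u v| ≤ β * ‖u‖ * ‖v‖) (hRf : ∀ v, Lf (Rf v) = v) (hρ : ∀ v, ‖Rf v‖ ≤ ρ * ‖v‖)
    {w : E} {y : V} (hLw : L w = y) (hδ₂ : ‖L w - Lf w‖ ≤ δ₂ * ‖w‖)
    {A ℓ : ℝ} (hδ₁ : Bf w w - δ₁ * ‖w‖ ^ 2 ≤ A) (hμ : ℓ ≤ μ * ‖w‖ ^ 2)
    {m : ℝ} (hm : ∀ w', Lf w' = y → m ≤ Bf w' w') :
    m - (δ₁ + μ + β * (ρ * δ₂) * (2 + ρ * δ₂)) * ‖w‖ ^ 2 ≤ A - ℓ := by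
  have h := secondVariation_ge_flatMin_sub Bf L Lf hβ0 hρ0 hβ hRf hρ hLw hδ₂ hδ₁ hm
  have key : (δ₁ + μ + β * (ρ * δ₂) * (2 + ρ * δ₂)) * ‖w‖ ^ 2
      = (δ₁ + β * (ρ * δ₂) * (2 + ρ * δ₂)) * ‖w‖ ^ 2 + μ * ‖w‖ ^ 2 := by ring
  rw [key]
  linarith

/-- **THE SAME IN TERMS OF THE DATUM VELOCITY**: with the boundedness letter (K) `‖w‖ ≤ K‖y‖` of the linearised minimiser ([15] Sect. C–E) and
non-negative letters, `m − Cerr·‖y‖² ≤ a₂(w,w) − λ₀(Φ₂(w,w))` with the EXPLICIT `Cerr = (δ₁ + μ + βρδ₂(2 + ρδ₂))·K²` — the `|E_A| ≤ O(1)(…)ε_k|B′|²` of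
print, its `O(1)` spelled out in the letters. [cite: Balaban1989LargeFieldII, (1.7) pp.357–358; Balaban1985Variational, (45)–(47) p.285] -/
theorem lagrangeHessian_ge_flatMin_sub_of_norm_le (Bf : E →L[ℝ] E →L[ℝ] ℝ) (L Lf : E →L[ℝ] V) {Rf : V → E}
    {δ₁ μ β ρ δ₂ K : ℝ} (hδ₁0 : 0 ≤ δ₁) (hμ0 : 0 ≤ μ) (hβ0 : 0 ≤ β) (hρ0 : 0 ≤ ρ) (hδ₂0 : 0 ≤ δ₂)
    (hβ : ∀ u v, |Bf u v| ≤ β * ‖u‖ * ‖v‖) (hRf : ∀ v, Lf (Rf v) = v) (hρ : ∀ v, ‖Rf v‖ ≤ ρ * ‖v‖)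
    {w : E} {y : V} (hLw : L w = y) (hδ₂ : ‖L w - Lf w‖ ≤ δ₂ * ‖w‖) (hK : ‖w‖ ≤ K * ‖y‖)
    {A ℓ : ℝ} (hδ₁ : Bf w w - δ₁ * ‖w‖ ^ 2 ≤ A) (hμ : ℓ ≤ μ * ‖w‖ ^ 2)
    {m : ℝ} (hm : ∀ w', Lf w' = y → m ≤ Bf w' w') :
    m - (δ₁ + μ + β * (ρ * δ₂) * (2 + ρ * δ₂)) * K ^ 2 * ‖y‖ ^ 2 ≤ A - ℓ := by
  have h := lagrangeHessian_ge_flatMin_sub Bf L Lf hβ0 hρ0 hβ hRf hρ hLw hδ₂ hδ₁ hμ hm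
  have hC : 0 ≤ δ₁ + μ + β * (ρ * δ₂) * (2 + ρ * δ₂) := by positivity
  have hw2 : ‖w‖ ^ 2 ≤ K ^ 2 * ‖y‖ ^ 2 := by
    have h1 : ‖w‖ ^ 2 ≤ (K * ‖y‖) ^ 2 := pow_le_pow_left₀ (norm_nonneg _) hK 2
    calc ‖w‖ ^ 2 ≤ (K * ‖y‖) ^ 2 := h1
      _ = K ^ 2 * ‖y‖ ^ 2 := by ring
  have h2 : (δ₁ + μ + β * (ρ * δ₂) * (2 + ρ * δ₂)) * ‖w‖ ^ 2
      ≤ (δ₁ + μ + β * (ρ * δ₂) * (2 + ρ * δ₂)) * (K ^ 2 * ‖y‖ ^ 2) := mul_le_mul_of_nonneg_left hw2 hC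
  have h3 : (δ₁ + μ + β * (ρ * δ₂) * (2 + ρ * δ₂)) * (K ^ 2 * ‖y‖ ^ 2)
      = (δ₁ + μ + β * (ρ * δ₂) * (2 + ρ * δ₂)) * K ^ 2 * ‖y‖ ^ 2 := by ring
  linarith

/-- **LETTER (μ) DECOMPOSED — THE MULTIPLIER IS THE CURRENT THROUGH A RIGHT INVERSE**: if the first variation `φ = Da(x₀)` has the Lagrange form
`φ = λ₀ ∘ L` (`B11Eq177CriticalFamilyDerivative.exists_multiplier_of_surjective`) and `R` is a right inverse of `L = DΦ(x₀)` with `‖Rv‖ ≤ ρ‖v‖`, then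
`λ₀ = φ ∘ R` and `|λ₀ v| ≤ j·ρ·‖v‖` for `|φ x| ≤ j‖x‖` — `j` the size of the CURRENT `J_{k,Z}` of (1.12) at the background (small field ⇒ small).
[cite: Balaban1989LargeFieldII, (1.12) p.359; Balaban1985Variational, (82)–(83) p.290, (170)–(171) p.305] -/
theorem abs_multiplier_apply_le (φ : E →L[ℝ] ℝ) (L : E →L[ℝ] V) {R : V → E} (hR : ∀ v, L (R v) = v) {lam : V →L[ℝ] ℝ}
    (hlam : φ = lam.comp L) {j ρ : ℝ} (hj0 : 0 ≤ j) (hj : ∀ x, |φ x| ≤ j * ‖x‖) (hρ : ∀ v, ‖R v‖ ≤ ρ * ‖v‖) (v : V) :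
    |lam v| ≤ j * ρ * ‖v‖ := by
  have h1 : lam v = φ (R v) := by rw [hlam, ContinuousLinearMap.comp_apply, hR]
  rw [h1]
  calc |φ (R v)| ≤ j * ‖R v‖ := hj _
    _ ≤ j * (ρ * ‖v‖) := mul_le_mul_of_nonneg_left (hρ v) hj0
    _ = j * ρ * ‖v‖ := by ring

/-- **LETTER (μ) FROM ITS THREE FACTORS**: current bound `|Da(x₀)x| ≤ j‖x‖`, right-inverse bound `ρ`, curvature of the constraint chart on the velocity
`‖Φ₂(w,w)‖ ≤ M₂‖w‖²` ⇒ `λ₀(Φ₂(w,w)) ≤ jρM₂·‖w‖²`, i.e. `μ = j·ρ·M₂` in `lagrangeHessian_ge_flatMin_sub`.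
[cite: Balaban1989LargeFieldII, (1.12) p.359, p.357; Balaban1985Variational, (82)–(83) p.290] -/
theorem multiplier_letter_of_current (φ : E →L[ℝ] ℝ) (L : E →L[ℝ] V) {R : V → E} (hR : ∀ v, L (R v) = v) {lam : V →L[ℝ] ℝ}
    (hlam : φ = lam.comp L) {j ρ M₂ : ℝ} (hj0 : 0 ≤ j) (hρ0 : 0 ≤ ρ) (hj : ∀ x, |φ x| ≤ j * ‖x‖) (hρ : ∀ v, ‖R v‖ ≤ ρ * ‖v‖)
    (Φ₂ : E →L[ℝ] E →L[ℝ] V) {w : E} (hM : ‖Φ₂ w w‖ ≤ M₂ * ‖w‖ ^ 2) :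
    lam (Φ₂ w w) ≤ j * ρ * M₂ * ‖w‖ ^ 2 := by
  have h := abs_multiplier_apply_le φ L hR hlam hj0 hj hρ (Φ₂ w w)
  have h2 : j * ρ * ‖Φ₂ w w‖ ≤ j * ρ * (M₂ * ‖w‖ ^ 2) := mul_le_mul_of_nonneg_left hM (mul_nonneg hj0 hρ0)
  calc lam (Φ₂ w w) ≤ |lam (Φ₂ w w)| := le_abs_self _
    _ ≤ j * ρ * ‖Φ₂ w w‖ := h
    _ ≤ j * ρ * M₂ * ‖w‖ ^ 2 := by linarith

end Algebra

/-! ## §2  The value Hessian along a critical family at the near-flat background (dag-n12-w3's (1.12) shape) -/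

section ValueHessian

variable {E V G : Type*} [NormedAddCommGroup E] [NormedSpace ℝ E]
  [NormedAddCommGroup V] [NormedSpace ℝ V]
  [NormedAddCommGroup G] [NormedSpace ℝ G]

/-- ★★ **THE VALUE HESSIAN OF (1.3) AT THE NEAR-FLAT BACKGROUND DOMINATES THE FLAT EFFECTIVE FORM MINUS `Cerr′‖γ′h‖²`, ONE-SIDED.**  In the situation of
dag-n12-w3's `hessian_value_criticalFamily` — the action `a` and constraint `Φ` in charts at the background `x₀` with second derivatives `a₂`, `Φ₂`,
the Lagrange form `Da(x₀) = λ₀ ∘ DΦ(x₀)` of constrained criticality, ANY twice-differentiable family `γ` through `x₀` — and for a datum map AFFINE in the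
parameter direction `h` as seen by the multiplier (`λ₀(D²(Φ∘γ)(g₀)[h,h]) = 0`; print's `B′` itself), the value Hessian is `a₂(w,w) − λ₀(Φ₂(w,w))`,
`w := γ′h`; so under the letters of `lagrangeHessian_ge_flatMin_sub` at `w` (with `L := DΦ(x₀)`, `y := DΦ(x₀)w`): for every `m` dominated by the flat
second variation `B♭` on the flat fibre of `y`, `m − (δ₁ + μ + βρδ₂(2 + ρδ₂))‖γ′h‖² ≤ D²(a∘γ)(g₀)[h,h]`.
[cite: Balaban1989LargeFieldII, (1.7) pp.357–358, (1.12) p.359; Balaban1985Variational, (174)–(177) pp.305–306, (47) p.285] -/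
theorem hessian_value_criticalFamily_ge_flatMin_sub {a : E → ℝ} {Φ : E → V} {γ : G → E} {g₀ : G} {x₀ : E}
    (hγ₀ : γ g₀ = x₀) {γ' : G →L[ℝ] E} (hγ : HasFDerivAt γ γ' g₀) {γ₂ : G →L[ℝ] G →L[ℝ] E}
    (hγ₂ : HasFDerivAt (fun g => fderiv ℝ γ g) γ₂ g₀) (hγd : ∀ᶠ g in 𝓝 g₀, DifferentiableAt ℝ γ g)
    {a₂ : E →L[ℝ] E →L[ℝ] ℝ} (ha₂ : HasFDerivAt (fun x => fderiv ℝ a x) a₂ x₀) (had : ∀ᶠ x in 𝓝 x₀, DifferentiableAt ℝ a x)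
    {Φ₂ : E →L[ℝ] E →L[ℝ] V} (hΦ₂ : HasFDerivAt (fun x => fderiv ℝ Φ x) Φ₂ x₀) (hΦd : ∀ᶠ x in 𝓝 x₀, DifferentiableAt ℝ Φ x)
    {lam : V →L[ℝ] ℝ} (hlam : fderiv ℝ a x₀ = lam.comp (fderiv ℝ Φ x₀)) (h : G)
    (haff : lam (fderiv ℝ (fun g => fderiv ℝ (fun g => Φ (γ g)) g) g₀ h h) = 0)
    (Bf : E →L[ℝ] E →L[ℝ] ℝ) (Lf : E →L[ℝ] V) {Rf : V → E} {δ₁ μ β ρ δ₂ : ℝ} (hβ0 : 0 ≤ β) (hρ0 : 0 ≤ ρ)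
    (hβ : ∀ u v, |Bf u v| ≤ β * ‖u‖ * ‖v‖) (hRf : ∀ v, Lf (Rf v) = v) (hρ : ∀ v, ‖Rf v‖ ≤ ρ * ‖v‖)
    (hδ₂ : ‖fderiv ℝ Φ x₀ (γ' h) - Lf (γ' h)‖ ≤ δ₂ * ‖γ' h‖)
    (hδ₁ : Bf (γ' h) (γ' h) - δ₁ * ‖γ' h‖ ^ 2 ≤ a₂ (γ' h) (γ' h))
    (hμ : lam (Φ₂ (γ' h) (γ' h)) ≤ μ * ‖γ' h‖ ^ 2)
    {m : ℝ} (hm : ∀ w', Lf w' = fderiv ℝ Φ x₀ (γ' h) → m ≤ Bf w' w') :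
    m - (δ₁ + μ + β * (ρ * δ₂) * (2 + ρ * δ₂)) * ‖γ' h‖ ^ 2
      ≤ fderiv ℝ (fun g => fderiv ℝ (fun g => a (γ g)) g) g₀ h h := by
  rw [hessian_value_criticalFamily hγ₀ hγ hγ₂ hγd ha₂ had hΦ₂ hΦd hlam h h, haff, add_zero]
  exact lagrangeHessian_ge_flatMin_sub Bf (fderiv ℝ Φ x₀) Lf hβ0 hρ0 hβ hRf hρ rfl hδ₂ hδ₁ hμ hm

/-- **THE SAME WITH `Cerr‖y‖²`** (`y = DΦ(x₀)(γ′h)` the datum velocity, letter (K) `‖γ′h‖ ≤ K‖y‖`): `m − Cerr‖y‖² ≤ D²(a∘γ)(g₀)[h,h]`,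
`Cerr = (δ₁ + μ + βρδ₂(2 + ρδ₂))·K²` — the one-sided (1.7) letter `h17`'s shape `γ₀·circ − Cerr‖X‖² ≤ Qv` once `m := γ₀·circ(X)` (the lane's Federbush
bound on the flat fibre) and `‖y‖ ≤ ‖X‖`. [cite: Balaban1989LargeFieldII, (1.7) pp.357–358; Balaban1989LargeFieldI, Prop. 1 (1.77)–(1.78) p.194] -/
theorem hessian_value_criticalFamily_ge_flatMin_sub_of_norm_le {a : E → ℝ} {Φ : E → V} {γ : G → E} {g₀ : G} {x₀ : E}
    (hγ₀ : γ g₀ = x₀) {γ' : G →L[ℝ] E} (hγ : HasFDerivAt γ γ' g₀) {γ₂ : G →L[ℝ] G →L[ℝ] E}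
    (hγ₂ : HasFDerivAt (fun g => fderiv ℝ γ g) γ₂ g₀) (hγd : ∀ᶠ g in 𝓝 g₀, DifferentiableAt ℝ γ g)
    {a₂ : E →L[ℝ] E →L[ℝ] ℝ} (ha₂ : HasFDerivAt (fun x => fderiv ℝ a x) a₂ x₀) (had : ∀ᶠ x in 𝓝 x₀, DifferentiableAt ℝ a x)
    {Φ₂ : E →L[ℝ] E →L[ℝ] V} (hΦ₂ : HasFDerivAt (fun x => fderiv ℝ Φ x) Φ₂ x₀) (hΦd : ∀ᶠ x in 𝓝 x₀, DifferentiableAt ℝ Φ x)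
    {lam : V →L[ℝ] ℝ} (hlam : fderiv ℝ a x₀ = lam.comp (fderiv ℝ Φ x₀)) (h : G)
    (haff : lam (fderiv ℝ (fun g => fderiv ℝ (fun g => Φ (γ g)) g) g₀ h h) = 0)
    (Bf : E →L[ℝ] E →L[ℝ] ℝ) (Lf : E →L[ℝ] V) {Rf : V → E} {δ₁ μ β ρ δ₂ K : ℝ}
    (hδ₁0 : 0 ≤ δ₁) (hμ0 : 0 ≤ μ) (hβ0 : 0 ≤ β) (hρ0 : 0 ≤ ρ) (hδ₂0 : 0 ≤ δ₂)
    (hβ : ∀ u v, |Bf u v| ≤ β * ‖u‖ * ‖v‖) (hRf : ∀ v, Lf (Rf v) = v) (hρ : ∀ v, ‖Rf v‖ ≤ ρ * ‖v‖)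
    (hδ₂ : ‖fderiv ℝ Φ x₀ (γ' h) - Lf (γ' h)‖ ≤ δ₂ * ‖γ' h‖) (hK : ‖γ' h‖ ≤ K * ‖fderiv ℝ Φ x₀ (γ' h)‖)
    (hδ₁ : Bf (γ' h) (γ' h) - δ₁ * ‖γ' h‖ ^ 2 ≤ a₂ (γ' h) (γ' h))
    (hμ : lam (Φ₂ (γ' h) (γ' h)) ≤ μ * ‖γ' h‖ ^ 2)
    {m : ℝ} (hm : ∀ w', Lf w' = fderiv ℝ Φ x₀ (γ' h) → m ≤ Bf w' w') :
    m - (δ₁ + μ + β * (ρ * δ₂) * (2 + ρ * δ₂)) * K ^ 2 * ‖fderiv ℝ Φ x₀ (γ' h)‖ ^ 2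
      ≤ fderiv ℝ (fun g => fderiv ℝ (fun g => a (γ g)) g) g₀ h h := by
  rw [hessian_value_criticalFamily hγ₀ hγ hγ₂ hγd ha₂ had hΦ₂ hΦd hlam h h, haff, add_zero]
  exact lagrangeHessian_ge_flatMin_sub_of_norm_le Bf (fderiv ℝ Φ x₀) Lf hδ₁0 hμ0 hβ0 hρ0 hδ₂0 hβ hRf hρ rfl hδ₂ hK hδ₁ hμ hm

end ValueHessian

/-! ## §3  Two backgrounds: the near-flat value Hessian dominates the flat value Hessian (print's sentence, one-sided) -/

section TwoBackgrounds

variable {E V G G' : Type*} [NormedAddCommGroup E] [NormedSpace ℝ E]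
  [NormedAddCommGroup V] [NormedSpace ℝ V] [FiniteDimensional ℝ V]
  [NormedAddCommGroup G] [NormedSpace ℝ G] [NormedAddCommGroup G'] [NormedSpace ℝ G']

/-- ★ **PRINT'S SENTENCE, ONE-SIDED**: «the leading term in the expansion is the quadratic form with the background field identically equal to 1» up to
`|E_A| ≤ O(1)(…)|B′|²` (p. 357–358).  Two families with the SAME datum velocity `y = DΦ(x₀)(γ′h) = DΦ♭(x♭)(γ♭′h♭)`: `γ` through the near-flat
CONSTRAINED-critical background `x₀` (data of `hessian_value_criticalFamily_ge_flatMin_sub`, flat letters read with `B♭ := D²a♭(x♭)`,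
`L♭ := DΦ♭(x♭)`), and `γ♭` through the flat UNCONSTRAINED-critical background `x♭` (`Da♭(x♭) = 0`, members tangent-critical on their fibres, `DΦ♭(x♭)`
onto, `D²a♭(x♭) ≥ 0` on `ker DΦ♭(x♭)` — dag-n12-w3 §4, whose `hessian_value_le_secondVariation_of_fderiv_eq_zero` makes the flat value Hessian the MINIMUM
of `B♭` over the flat fibre, [10] (1.64)–(1.66)'s `⟨B′, Δ_kB′⟩`).  THEN
`D²(a♭∘γ♭)(g♭)[h♭,h♭] − (δ₁ + μ + βρδ₂(2 + ρδ₂))‖γ′h‖² ≤ D²(a∘γ)(g₀)[h,h]`.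
[cite: Balaban1989LargeFieldII, p.357, (1.7) p.358, (1.12) p.359; Balaban1984PropagatorsI, (1.64)–(1.67) p.29; Balaban1985Variational, (36)–(47) pp.283–285] -/
theorem hessian_value_nearFlat_ge_hessian_value_flat_sub
    -- the near-flat constrained-critical background
    {a : E → ℝ} {Φ : E → V} {γ : G → E} {g₀ : G} {x₀ : E}
    (hγ₀ : γ g₀ = x₀) {γ' : G →L[ℝ] E} (hγ : HasFDerivAt γ γ' g₀) {γ₂ : G →L[ℝ] G →L[ℝ] E}
    (hγ₂ : HasFDerivAt (fun g => fderiv ℝ γ g) γ₂ g₀) (hγd : ∀ᶠ g in 𝓝 g₀, DifferentiableAt ℝ γ g)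
    {a₂ : E →L[ℝ] E →L[ℝ] ℝ} (ha₂ : HasFDerivAt (fun x => fderiv ℝ a x) a₂ x₀) (had : ∀ᶠ x in 𝓝 x₀, DifferentiableAt ℝ a x)
    {Φ₂ : E →L[ℝ] E →L[ℝ] V} (hΦ₂ : HasFDerivAt (fun x => fderiv ℝ Φ x) Φ₂ x₀) (hΦd : ∀ᶠ x in 𝓝 x₀, DifferentiableAt ℝ Φ x)
    {lam : V →L[ℝ] ℝ} (hlam : fderiv ℝ a x₀ = lam.comp (fderiv ℝ Φ x₀)) (h : G)
    (haff : lam (fderiv ℝ (fun g => fderiv ℝ (fun g => Φ (γ g)) g) g₀ h h) = 0)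
    -- the flat unconstrained-critical background
    {af : E → ℝ} {Φf : E → V} {γf : G' → E} {gf : G'} {xf : E}
    (hγf₀ : γf gf = xf) {γf' : G' →L[ℝ] E} (hγf : HasFDerivAt γf γf' gf) {γf₂ : G' →L[ℝ] G' →L[ℝ] E}
    (hγf₂ : HasFDerivAt (fun g => fderiv ℝ γf g) γf₂ gf) (hγfd : ∀ᶠ g in 𝓝 gf, DifferentiableAt ℝ γf g)
    {Bf : E →L[ℝ] E →L[ℝ] ℝ} (hBf : HasFDerivAt (fun x => fderiv ℝ af x) Bf xf) (hafd : ∀ᶠ x in 𝓝 xf, DifferentiableAt ℝ af x)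
    (h0f : fderiv ℝ af xf = 0)
    {Φf₂ : E →L[ℝ] E →L[ℝ] V} (hΦf₂ : HasFDerivAt (fun x => fderiv ℝ Φf x) Φf₂ xf)
    (hsurjf : Function.Surjective (fderiv ℝ Φf xf))
    (hcritf : ∀ᶠ g in 𝓝 gf, ∀ t, fderiv ℝ Φf (γf g) t = 0 → fderiv ℝ af (γf g) t = 0)
    (hposf : ∀ t, fderiv ℝ Φf xf t = 0 → 0 ≤ Bf t t) (hf : G')
    -- the same datum velocity
    (hvel : fderiv ℝ Φf xf (γf' hf) = fderiv ℝ Φ x₀ (γ' h))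
    -- the letters
    {Rf : V → E} {δ₁ μ β ρ δ₂ : ℝ} (hβ0 : 0 ≤ β) (hρ0 : 0 ≤ ρ)
    (hβ : ∀ u v, |Bf u v| ≤ β * ‖u‖ * ‖v‖) (hRf : ∀ v, fderiv ℝ Φf xf (Rf v) = v) (hρ : ∀ v, ‖Rf v‖ ≤ ρ * ‖v‖)
    (hδ₂ : ‖fderiv ℝ Φ x₀ (γ' h) - fderiv ℝ Φf xf (γ' h)‖ ≤ δ₂ * ‖γ' h‖)
    (hδ₁ : Bf (γ' h) (γ' h) - δ₁ * ‖γ' h‖ ^ 2 ≤ a₂ (γ' h) (γ' h))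
    (hμ : lam (Φ₂ (γ' h) (γ' h)) ≤ μ * ‖γ' h‖ ^ 2) :
    fderiv ℝ (fun g => fderiv ℝ (fun g => af (γf g)) g) gf hf hf - (δ₁ + μ + β * (ρ * δ₂) * (2 + ρ * δ₂)) * ‖γ' h‖ ^ 2
      ≤ fderiv ℝ (fun g => fderiv ℝ (fun g => a (γ g)) g) g₀ h h := by
  refine hessian_value_criticalFamily_ge_flatMin_sub hγ₀ hγ hγ₂ hγd ha₂ had hΦ₂ hΦd hlam h haff Bf (fderiv ℝ Φf xf)
    hβ0 hρ0 hβ hRf hρ hδ₂ hδ₁ hμ fun w' hw' => ?_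
  have hx : fderiv ℝ Φf xf w' = fderiv ℝ Φf xf (γf' hf) := by rw [hw', hvel]
  obtain ⟨heq, hle⟩ := hessian_value_le_secondVariation_of_fderiv_eq_zero hγf₀ hγf hγf₂ hγfd hBf hafd h0f hΦf₂ hsurjf
    hcritf hposf hf hx
  rw [heq]
  exact hle

end TwoBackgrounds

end Literature.MathematicalPhysics.QuantumFieldTheory.Balaban1983to89.B16Ineq17NearFlatOneSided

end
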